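import Mathlib
import Summits.MatrixMultiplication.MatrixMultiplication.Theorems.SubgroupIdentityDesigns.Negative.LevelOneFloor
import Summits.MatrixMultiplication.MatrixMultiplication.Theorems.SubgroupIdentityDesigns.Negative.StandardLines
import Summits.MatrixMultiplication.MatrixMultiplication.Theorems.SubgroupIdentityDesigns.Negative.SingerConj

/-!
# Level-one witnesses avoid Singer cycles (witness form, all three members)

Route `LevelGradedCohnUmans`, crux `SubgroupIdentityDesigns`, the `(m,k) = (2,1)` cell.  A level-one
WITNESS (TPP + level-`1` identity design + the crux inequality `budget < (|H₁||H₂||H₃|)^{(2+ε)/3}`,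
`-2 < ε ≤ 1`, `p ≥ 3`) has every member of order `≥ p + 1` (`levelOne_witness_window`), hence every
member non-trivial; TPP makes the members pairwise disjoint (`subgroupTPP_disjoint`).  So if a
member `Hᵢ` contains a conjugate `x K x⁻¹` of the Singer cycle, any `h ≠ 1` of another member gives
`k₀ = x⁻¹ h x ∉ K`, and `SingerConj` kills the design.  Net statements
`no_levelOne_witness_of_singer_member₁/₂/₃`: NO MEMBER OF A LEVEL-ONE WITNESS CONTAINS A CYCLIC
IRREDUCIBLE SUBGROUP OF ORDER `p² - 1` (`p` odd).  Hypothesis-free in the triple beyond the witness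
clauses themselves.  VALUE = THEOREM, NOT summit progress; the crux item
stmt-MatrixMultiplication-14079 is untouched and remains open.
-/

set_option linter.dupNamespace false

noncomputable section

open scoped BigOperators Classical

open Summit.MatrixMultiplication.MatrixMultiplication.Theorems.LieRankDesigns.Negative
  (GLm Mat budget)

open Literature.Barriers.MatrixMultiplication (SubgroupTPP)

namespace Summit.MatrixMultiplication.MatrixMultiplication.Theorems.SubgroupIdentityDesigns.Negative

section SingerWitness

variable {p : ℕ} [hp : Fact p.Prime]

/-- A subgroup of order `≥ p + 1` has a non-trivial element. -/
theorem exists_ne_one_of_card_ge {H : Subgroup (GLm p 2)} (hH : p + 1 ≤ Nat.card H) :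
    ∃ h ∈ H, h ≠ 1 := by
  by_contra hno
  push Not at hno
  have hbot : H = ⊥ := (Subgroup.eq_bot_iff_forall _).mpr hno
  have hcard : Nat.card H = 1 := by rw [hbot]; exact Subgroup.card_bot
  have := hp.out.two_le
  omega

/-- **No member `H₁` of a level-one witness contains a conjugate Singer cycle** (`p` odd). -/
theorem no_levelOne_witness_of_singer_member₁ (hp3 : 3 ≤ p) {ε : ℝ} (hε : -2 < ε) (hε1 : ε ≤ 1)
    {H₁ H₂ H₃ : Subgroup (GLm p 2)} (htpp : SubgroupTPP H₁ H₂ H₃)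
    (hdesign : ∃ c : Mat p 2 → ℂ, (∀ M, 1 < M.rank → c M = 0) ∧
      (∑ M, c M * ZMod.stdAddChar (Matrix.trace (M * ((1 : GLm p 2) : Mat p 2)))) = 1 ∧
      ∀ a ∈ H₁, ∀ b ∈ H₂, ∀ g ∈ H₃, a * b * g ≠ 1 →
        (∑ M, c M *
          ZMod.stdAddChar (Matrix.trace (M * ((a * b * g : GLm p 2) : Mat p 2)))) = 0)
    (hwit : budget p 2 1 (2 + ε) <
      ((Nat.card H₁ * Nat.card H₂ * Nat.card H₃ : ℕ) : ℝ) ^ ((2 + ε) / 3))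
    (n : ZMod p) (hn : ∀ x : ZMod p, x * x ≠ n) (K : Subgroup (GLm p 2))
    (hKshape : ∀ k ∈ K, ((k : GLm p 2) : Mat p 2) 0 1 = n * ((k : GLm p 2) : Mat p 2) 1 0 ∧
      ((k : GLm p 2) : Mat p 2) 1 1 = ((k : GLm p 2) : Mat p 2) 0 0)
    (hKall : ∀ k : GLm p 2, (k : Mat p 2) 0 1 = n * (k : Mat p 2) 1 0 →
      (k : Mat p 2) 1 1 = (k : Mat p 2) 0 0 → k ∈ K)
    (x : GLm p 2) (hKH : ∀ k ∈ K, x * k * x⁻¹ ∈ H₁) : False := by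
  obtain ⟨-, ⟨hlo, -⟩, -⟩ := levelOne_witness_window hp3 hε hε1 htpp hdesign hwit
  obtain ⟨h, hh, hh1⟩ := exists_ne_one_of_card_ge hlo
  have hconj : x * (x⁻¹ * h * x) * x⁻¹ = h := by group
  refine no_levelOne_design_of_singer_conj₁₂ n hn K hKshape hKall x hKH (x⁻¹ * h * x)
    (by rw [hconj]; exact hh) (fun hk => hh1 ?_) hdesign
  have hKi := hKH _ hk
  rw [hconj] at hKi
  exact Subgroup.disjoint_def.mp (StandardLines.subgroupTPP_disjoint htpp).1 hKi hh

/-- **No member `H₂` of a level-one witness contains a conjugate Singer cycle** (`p` odd). -/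
theorem no_levelOne_witness_of_singer_member₂ (hp3 : 3 ≤ p) {ε : ℝ} (hε : -2 < ε) (hε1 : ε ≤ 1)
    {H₁ H₂ H₃ : Subgroup (GLm p 2)} (htpp : SubgroupTPP H₁ H₂ H₃)
    (hdesign : ∃ c : Mat p 2 → ℂ, (∀ M, 1 < M.rank → c M = 0) ∧
      (∑ M, c M * ZMod.stdAddChar (Matrix.trace (M * ((1 : GLm p 2) : Mat p 2)))) = 1 ∧
      ∀ a ∈ H₁, ∀ b ∈ H₂, ∀ g ∈ H₃, a * b * g ≠ 1 →
        (∑ M, c M *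
          ZMod.stdAddChar (Matrix.trace (M * ((a * b * g : GLm p 2) : Mat p 2)))) = 0)
    (hwit : budget p 2 1 (2 + ε) <
      ((Nat.card H₁ * Nat.card H₂ * Nat.card H₃ : ℕ) : ℝ) ^ ((2 + ε) / 3))
    (n : ZMod p) (hn : ∀ x : ZMod p, x * x ≠ n) (K : Subgroup (GLm p 2))
    (hKshape : ∀ k ∈ K, ((k : GLm p 2) : Mat p 2) 0 1 = n * ((k : GLm p 2) : Mat p 2) 1 0 ∧
      ((k : GLm p 2) : Mat p 2) 1 1 = ((k : GLm p 2) : Mat p 2) 0 0)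
    (hKall : ∀ k : GLm p 2, (k : Mat p 2) 0 1 = n * (k : Mat p 2) 1 0 →
      (k : Mat p 2) 1 1 = (k : Mat p 2) 0 0 → k ∈ K)
    (x : GLm p 2) (hKH : ∀ k ∈ K, x * k * x⁻¹ ∈ H₂) : False := by
  obtain ⟨⟨hlo, -⟩, -, -⟩ := levelOne_witness_window hp3 hε hε1 htpp hdesign hwit
  obtain ⟨h, hh, hh1⟩ := exists_ne_one_of_card_ge hlo
  have hconj : x * (x⁻¹ * h * x) * x⁻¹ = h := by group
  refine no_levelOne_design_of_singer_conj₂₁ n hn K hKshape hKall x hKH (x⁻¹ * h * x)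
    (by rw [hconj]; exact hh) (fun hk => hh1 ?_) hdesign
  have hKi := hKH _ hk
  rw [hconj] at hKi
  exact Subgroup.disjoint_def.mp (StandardLines.subgroupTPP_disjoint htpp).1 hh hKi

/-- **No member `H₃` of a level-one witness contains a conjugate Singer cycle** (`p` odd). -/
theorem no_levelOne_witness_of_singer_member₃ (hp3 : 3 ≤ p) {ε : ℝ} (hε : -2 < ε) (hε1 : ε ≤ 1)
    {H₁ H₂ H₃ : Subgroup (GLm p 2)} (htpp : SubgroupTPP H₁ H₂ H₃)
    (hdesign : ∃ c : Mat p 2 → ℂ, (∀ M, 1 < M.rank → c M = 0) ∧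
      (∑ M, c M * ZMod.stdAddChar (Matrix.trace (M * ((1 : GLm p 2) : Mat p 2)))) = 1 ∧
      ∀ a ∈ H₁, ∀ b ∈ H₂, ∀ g ∈ H₃, a * b * g ≠ 1 →
        (∑ M, c M *
          ZMod.stdAddChar (Matrix.trace (M * ((a * b * g : GLm p 2) : Mat p 2)))) = 0)
    (hwit : budget p 2 1 (2 + ε) <
      ((Nat.card H₁ * Nat.card H₂ * Nat.card H₃ : ℕ) : ℝ) ^ ((2 + ε) / 3))
    (n : ZMod p) (hn : ∀ x : ZMod p, x * x ≠ n) (K : Subgroup (GLm p 2))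
    (hKshape : ∀ k ∈ K, ((k : GLm p 2) : Mat p 2) 0 1 = n * ((k : GLm p 2) : Mat p 2) 1 0 ∧
      ((k : GLm p 2) : Mat p 2) 1 1 = ((k : GLm p 2) : Mat p 2) 0 0)
    (hKall : ∀ k : GLm p 2, (k : Mat p 2) 0 1 = n * (k : Mat p 2) 1 0 →
      (k : Mat p 2) 1 1 = (k : Mat p 2) 0 0 → k ∈ K)
    (x : GLm p 2) (hKH : ∀ k ∈ K, x * k * x⁻¹ ∈ H₃) : False := by
  obtain ⟨⟨hlo, -⟩, -, -⟩ := levelOne_witness_window hp3 hε hε1 htpp hdesign hwit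
  obtain ⟨h, hh, hh1⟩ := exists_ne_one_of_card_ge hlo
  have hconj : x * (x⁻¹ * h * x) * x⁻¹ = h := by group
  refine no_levelOne_design_of_singer_conj₃₁ n hn K hKshape hKall x hKH (x⁻¹ * h * x)
    (by rw [hconj]; exact hh) (fun hk => hh1 ?_) hdesign
  have hKi := hKH _ hk
  rw [hconj] at hKi
  exact Subgroup.disjoint_def.mp (StandardLines.subgroupTPP_disjoint htpp).2.1 hh hKi

end SingerWitness

end Summit.MatrixMultiplication.MatrixMultiplication.Theorems.SubgroupIdentityDesigns.Negative

end
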